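import Summits.CriticalPhenomena.SAWScalingLimit.Theses.SAWDefectDecoherence

/-!
# `BoundaryClosureR`, line `pick-half-plane`, stub `stub_gateTrace` (a): the boundary Hopf lemma
# for a holomorphic function real on a line and of positive imaginary part above it

Support for the regularity of the conformal data along the flat gate (sub-goal
`identification_gateRegularity`, file `…IdentificationGateRegularity.lean`).  The one non-formal
point of "`Φ'` extends zero-free across the gate" is that the reflected map has NON-VANISHING
DERIVATIVE at the gate points.  Classically this is "injective ⇒ `Φ' ≠ 0`" (argument principle);
here it is proved WITHOUT injectivity and without the argument principle, from positivity alone: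

* `deriv_ne_zero_of_im_pos` — if `R` is analytic at a real point `w`, real on the real axis near
  `w` and of positive imaginary part at the points above the axis near `w`, then `deriv R w ≠ 0`.
  Proof: write `R − R w = (z − w)ⁿ · g` with `g w ≠ 0` (isolated zeros, Mathlib's
  `AnalyticAt.exists_eventuallyEq_pow_smul_nonzero_iff`); `g w` is real (approach `w` along the
  axis); if `n ≥ 2`, approach `w` along the ray of angle `3π/(2n)` (if `g w > 0`) or `π/(2n)`
  (if `g w < 0`): the ray lies in the upper half-plane but `Im R = ∓ sⁿ Re g → ` negative —
  contradiction; so `n = 1` and `deriv R w = g w ≠ 0`.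
* `im_deriv_eq_zero_of_real` — such an `R` has REAL derivative at `w` (difference quotients along
  the axis are real).

Both are [folklore] (the boundary form of the open mapping theorem / Hopf's lemma for `Im R`).
-/

noncomputable section

open scoped Topology
open Filter Set Complex

namespace Summit.CriticalPhenomena.SAWScalingLimit.Theorems.PickHalfPlane.Identification

/-- The ray `s ↦ w + s·u` (`s → 0⁺`) tends to `w`. [folklore] -/
theorem tendsto_ray (w u : ℂ) : Tendsto (fun s : ℝ => w + (s : ℂ) * u) (𝓝[>] 0) (𝓝 w) := by
  have : Tendsto (fun s : ℝ => w + (s : ℂ) * u) (𝓝 0) (𝓝 (w + ((0 : ℝ) : ℂ) * u)) :=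
    ((continuous_const.add ((continuous_ofReal).mul continuous_const)).tendsto 0)
  rw [ofReal_zero, zero_mul, add_zero] at this
  exact this.mono_left nhdsWithin_le_nhds

/-- The real ray `s ↦ w + s` (`s → 0⁺`) tends to `w`. [folklore] -/
theorem tendsto_ray_one (w : ℂ) : Tendsto (fun s : ℝ => w + (s : ℂ)) (𝓝[>] 0) (𝓝 w) := by
  simpa using tendsto_ray w 1

/-- **The derivative of a function real on the real axis is real there.** If `R` is differentiable
at a real point `w` and real at the real points near `w`, then `(deriv R w).im = 0` (difference
quotients along the axis are real). [folklore] -/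
theorem im_deriv_eq_zero_of_real {R : ℂ → ℂ} {w : ℂ} (hw : w.im = 0) (hd : DifferentiableAt ℂ R w)
    (hreal : ∀ᶠ z in 𝓝 w, z.im = 0 → (R z).im = 0) : (deriv R w).im = 0 := by
  -- the difference quotient along the real ray tends to the derivative
  have hslope : Tendsto (fun s : ℝ => (R (w + (s : ℂ)) - R w) / (s : ℂ)) (𝓝[>] 0)
      (𝓝 (deriv R w)) := by
    have h1 : Tendsto (fun t : ℂ => t⁻¹ • (R (w + t) - R w)) (𝓝[≠] (0 : ℂ)) (𝓝 (deriv R w)) :=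
      hd.hasDerivAt.tendsto_slope_zero
    have h2 : Tendsto (fun s : ℝ => ((s : ℂ))) (𝓝[>] (0 : ℝ)) (𝓝[≠] (0 : ℂ)) :=
      tendsto_nhdsWithin_iff.2 ⟨(continuous_ofReal.tendsto' 0 0 ofReal_zero).mono_left
        nhdsWithin_le_nhds, eventually_mem_nhdsWithin.mono fun s hs => by
          simpa using (ne_of_gt (show (0 : ℝ) < s from hs))⟩
    refine (h1.comp h2).congr fun s => ?_
    simp only [Function.comp_apply, smul_eq_mul, div_eq_inv_mul]
  -- and it is real for small `s > 0`
  have hrealq : ∀ᶠ s : ℝ in 𝓝[>] 0, ((R (w + (s : ℂ)) - R w) / (s : ℂ)).im = 0 := by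
    have hw0 : (R w).im = 0 := hreal.self_of_nhds hw
    filter_upwards [(tendsto_ray_one w).eventually hreal] with s hs
    have him : (w + (s : ℂ)).im = 0 := by simp [hw]
    rw [div_ofReal_im, sub_im, hs him, hw0, sub_zero, zero_div]
  have hclosed : IsClosed {v : ℂ | v.im = 0} := isClosed_eq continuous_im continuous_const
  exact hclosed.mem_of_tendsto hslope hrealq

/-- **Boundary Hopf lemma for holomorphic functions (positivity ⇒ non-vanishing derivative).** Let
`R` be analytic at a real point `w`, real at the real points near `w`, and of positive imaginary
part at the points of the open upper half-plane near `w`.  Then `deriv R w ≠ 0`.  (Isolated zeros: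
`R − R w = (z − w)ⁿ g`, `g w ≠ 0` real; for `n ≥ 2` the ray of angle `3π/(2n)` or `π/(2n)` from
`w` lies in the upper half-plane while `Im R < 0` along it.)  No injectivity is used. [folklore] -/
theorem deriv_ne_zero_of_im_pos {R : ℂ → ℂ} {w : ℂ} (hw : w.im = 0) (hR : AnalyticAt ℂ R w)
    (hreal : ∀ᶠ z in 𝓝 w, z.im = 0 → (R z).im = 0)
    (hpos : ∀ᶠ z in 𝓝 w, 0 < z.im → 0 < (R z).im) : deriv R w ≠ 0 := by
  have hw0 : (R w).im = 0 := hreal.self_of_nhds hw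
  set F : ℂ → ℂ := fun z => R z - R w with hFdef
  have hF : AnalyticAt ℂ F w := hR.sub analyticAt_const
  -- `F` is not identically zero near `w`: above the axis `Im R > 0 = Im (R w)`
  have hnz : ¬∀ᶠ z in 𝓝 w, F z = 0 := by
    intro h0
    have hup : Tendsto (fun s : ℝ => w + (s : ℂ) * I) (𝓝[>] 0) (𝓝 w) := tendsto_ray w I
    have h1 := hup.eventually h0
    have h2 := hup.eventually hpos
    obtain ⟨s, ⟨hs0, hs1⟩, hs2⟩ := ((eventually_mem_nhdsWithin.and h1).and h2).exists
    have him : 0 < (w + (s : ℂ) * I).im := by simpa [hw] using (show (0 : ℝ) < s from hs0)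
    have := hs2 him
    rw [show R (w + (s : ℂ) * I) = F (w + (s : ℂ) * I) + R w by simp [hFdef], hs1, zero_add, hw0]
      at this
    exact lt_irrefl _ this
  obtain ⟨n, g, hg, hg0, hFg⟩ := hF.exists_eventuallyEq_pow_smul_nonzero_iff.2 hnz
  -- `n ≠ 0` since `F w = 0`
  have hn0 : n ≠ 0 := by
    rintro rfl
    have := hFg.self_of_nhds
    simp [hFdef] at this
    exact hg0 this.symm
  -- `g w` is real: along the axis `F` and `(z − w)ⁿ` are real
  have hgreal : (g w).im = 0 := by
    have hray := tendsto_ray_one w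
    have hlim : Tendsto (fun s : ℝ => g (w + (s : ℂ))) (𝓝[>] 0) (𝓝 (g w)) :=
      (hg.continuousAt.tendsto).comp hray
    have hev : ∀ᶠ s : ℝ in 𝓝[>] 0, (g (w + (s : ℂ))).im = 0 := by
      filter_upwards [hray.eventually hreal, hray.eventually hFg, eventually_mem_nhdsWithin]
        with s hs hsF hs0
      have him : (w + (s : ℂ)).im = 0 := by simp [hw]
      have hsF' : F (w + (s : ℂ)) = ((s : ℂ)) ^ n * g (w + (s : ℂ)) := by
        rw [hsF, add_sub_cancel_left, smul_eq_mul]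
      have hspos : (0 : ℝ) < s := hs0
      have hsn : ((s : ℂ)) ^ n ≠ 0 := pow_ne_zero _ (by exact_mod_cast hspos.ne')
      have hgq : g (w + (s : ℂ)) = F (w + (s : ℂ)) / (s : ℂ) ^ n := by
        rw [hsF', mul_div_cancel_left₀ _ hsn]
      have hFim : (F (w + (s : ℂ))).im = 0 := by
        simp only [hFdef, sub_im, hs him, hw0, sub_zero]
      rw [hgq, ← ofReal_pow, div_ofReal_im, hFim, zero_div]
    exact (isClosed_eq continuous_im continuous_const).mem_of_tendsto hlim hev
  -- the case `n = 1`: the derivative is `g w ≠ 0`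
  by_cases hn1 : n = 1
  · subst hn1
    have hderF : HasDerivAt F (g w) w := by
      have ha : HasDerivAt (fun z => (z - w) ^ 1) 1 w := by
        simpa using (hasDerivAt_id w).sub_const w
      have h1 := ha.smul hg.differentiableAt.hasDerivAt
      simp only [sub_self, pow_one, zero_smul, zero_add, one_smul] at h1
      refine h1.congr_of_eventuallyEq (hFg.mono fun z hz => ?_)
      rw [hz]
      simp [Pi.smul_apply', smul_eq_mul]
    have hderR : HasDerivAt R (g w) w := by
      have := hderF.add_const (R w)
      simpa [hFdef] using this
    rw [hderR.deriv]
    exact hg0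
  -- the case `n ≥ 2`: contradiction along a ray in the upper half-plane
  exfalso
  have hn2 : 2 ≤ n := by omega
  -- the angle and the unit vector
  set θ : ℝ := if 0 < (g w).re then 3 * Real.pi / (2 * n) else Real.pi / (2 * n) with hθdef
  have hnpos : (0 : ℝ) < n := by exact_mod_cast Nat.pos_of_ne_zero hn0
  have hθpos : 0 < θ := by
    rw [hθdef]; split_ifs <;> positivity
  have hθlt : θ < Real.pi := by
    have hn2' : (2 : ℝ) ≤ n := by exact_mod_cast hn2
    rw [hθdef]; split_ifs
    · rw [div_lt_iff₀ (by positivity)]; nlinarith [Real.pi_pos]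
    · rw [div_lt_iff₀ (by positivity)]; nlinarith [Real.pi_pos]
  set u : ℂ := exp ((θ : ℂ) * I) with hudef
  have hu_im : 0 < u.im := by
    rw [hudef, exp_ofReal_mul_I_im]
    exact Real.sin_pos_of_pos_of_lt_pi hθpos hθlt
  -- `uⁿ = ∓ I`
  have hI2 : exp (((Real.pi / 2 : ℝ) : ℂ) * I) = I := by
    rw [exp_mul_I, ← ofReal_cos, ← ofReal_sin, Real.cos_pi_div_two, Real.sin_pi_div_two]; simp
  have hun : u ^ n = if 0 < (g w).re then -I else I := by
    rw [hudef, ← exp_nat_mul, ← mul_assoc]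
    have hn' : (n : ℂ) ≠ 0 := by exact_mod_cast hn0
    split_ifs with hsgn
    · have e : (n : ℂ) * (θ : ℂ) = ((Real.pi : ℝ) : ℂ) + ((Real.pi / 2 : ℝ) : ℂ) := by
        rw [hθdef, if_pos hsgn]; push_cast; field_simp; ring
      rw [e, add_mul, exp_add, hI2, exp_pi_mul_I]; ring
    · have e : (n : ℂ) * (θ : ℂ) = ((Real.pi / 2 : ℝ) : ℂ) := by
        rw [hθdef, if_neg hsgn]; push_cast; field_simp
      rw [e, hI2]
  -- along the ray `w + s u`
  have hray := tendsto_ray w u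
  have hglim : Tendsto (fun s : ℝ => (g (w + (s : ℂ) * u)).re) (𝓝[>] 0) (𝓝 (g w).re) :=
    (continuous_re.tendsto _).comp ((hg.continuousAt.tendsto).comp hray)
  have hgre0 : (g w).re ≠ 0 := by
    intro h0; apply hg0; exact Complex.ext (by simpa using h0) (by simpa using hgreal)
  -- eventually `Re g` has the sign of `Re (g w)` and `Im R > 0` on the ray: contradiction
  have hsign : ∀ᶠ s : ℝ in 𝓝[>] 0, 0 < (g w).re * (g (w + (s : ℂ) * u)).re := by
    rcases lt_or_gt_of_ne hgre0 with hneg | hposre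
    · have : ∀ᶠ s : ℝ in 𝓝[>] 0, (g (w + (s : ℂ) * u)).re < (g w).re / 2 :=
        hglim (Iio_mem_nhds (by linarith))
      filter_upwards [this] with s hs; nlinarith
    · have : ∀ᶠ s : ℝ in 𝓝[>] 0, (g w).re / 2 < (g (w + (s : ℂ) * u)).re :=
        hglim (Ioi_mem_nhds (by linarith))
      filter_upwards [this] with s hs; nlinarith
  obtain ⟨s, hs0, hsF, hsP, hsS⟩ : ∃ s : ℝ, 0 < s ∧ F (w + (s : ℂ) * u) = ((w + (s : ℂ) * u) - w) ^ n • g (w + (s : ℂ) * u) ∧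
      (0 < (w + (s : ℂ) * u).im → 0 < (R (w + (s : ℂ) * u)).im) ∧ 0 < (g w).re * (g (w + (s : ℂ) * u)).re := by
    obtain ⟨s, h⟩ := (((eventually_mem_nhdsWithin.and (hray.eventually hFg)).and
      (hray.eventually hpos)).and hsign).exists
    exact ⟨s, h.1.1.1, h.1.1.2, h.1.2, h.2⟩
  have hzim : 0 < (w + (s : ℂ) * u).im := by
    rw [add_im, hw, zero_add, mul_im, ofReal_re, ofReal_im, zero_mul, add_zero]
    exact mul_pos hs0 hu_im
  have hRim : (R (w + (s : ℂ) * u)).im = (F (w + (s : ℂ) * u)).im := by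
    simp [hFdef, hw0]
  have hFval : F (w + (s : ℂ) * u) = ((s : ℂ)) ^ n * (u ^ n * g (w + (s : ℂ) * u)) := by
    rw [hsF, add_sub_cancel_left, smul_eq_mul, mul_pow]; ring
  have hspow : (0 : ℝ) < s ^ n := pow_pos hs0 n
  have key : (R (w + (s : ℂ) * u)).im < 0 := by
    rw [hRim, hFval, ← ofReal_pow, im_ofReal_mul, hun]
    split_ifs at hsS ⊢ with hsgn
    · have : (-I * g (w + (s : ℂ) * u)).im = -(g (w + (s : ℂ) * u)).re := by simp
      rw [this]
      have hgpos : 0 < (g (w + (s : ℂ) * u)).re := by nlinarith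
      nlinarith
    · have : (I * g (w + (s : ℂ) * u)).im = (g (w + (s : ℂ) * u)).re := by simp
      rw [this]
      have hgneg : (g (w + (s : ℂ) * u)).re < 0 := by
        have : (g w).re < 0 := lt_of_le_of_ne (not_lt.1 hsgn) hgre0
        nlinarith
      nlinarith
  exact absurd (hsP hzim) (not_lt.2 key.le)

/-- **The registered anchor `identification_gateHopf`** (∀-closed package of the two lemmas above):
at a real point `w`, a function analytic at `w`, real on the axis near `w` and of positive imaginary
part above the axis near `w` has NON-ZERO REAL derivative. [folklore] -/
theorem identification_gateHopf : ∀ (R : ℂ → ℂ) (w : ℂ), w.im = 0 → AnalyticAt ℂ R w →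
    (∀ᶠ z in 𝓝 w, z.im = 0 → (R z).im = 0) → (∀ᶠ z in 𝓝 w, 0 < z.im → 0 < (R z).im) →
    deriv R w ≠ 0 ∧ (deriv R w).im = 0 :=
  fun _ _ hw hR hreal hpos =>
    ⟨deriv_ne_zero_of_im_pos hw hR hreal hpos, im_deriv_eq_zero_of_real hw hR.differentiableAt hreal⟩

end Summit.CriticalPhenomena.SAWScalingLimit.Theorems.PickHalfPlane.Identification

end
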